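import Summits.BirchSwinnertonDyer.Rank1Residual.X11b.GlobalH2FiniteSupport
import Literature.NumberTheory.GaloisCohomology.PoitouTateSha
import HarnessLib

/-!
# A class of `H²(K, M)`, `M` FINITE, is locally zero at all but finitely many places (Milne ADT I Lemma 4.8 / Harari Prop. 17.6
# with Lemma 17.8: "the image of `β²` lies in `⊕_v H²(K_v, M)`") — every number field, every finite discrete Galois module

Crux K4 `SignedControlAtTwo` (stmt-BirchSwinnertonDyer-20309; routes `ThetaPartnerAtTwo` / `ResidualThetaTransportAtTwo`), line
`eulerchar` v14, stub 3 `stub_realThreeOrderTwoBase` (= the lead's binder `hbase`: `H³(F, T) ↪ ⊕_{w real} H³(F_w, T)` for the trivial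
module of order `2`).  Width seat w2 g7 reduced `hbase` to the `H²` norm statement (NORM_T) and laid the road B0–B7
(`Cruxes/SignedControlAtTwo/HBASE-ROAD-w2g7.md`); its step **B1 — FINITE SUPPORT of a global `H²`-class** ("the one piece with no tree
precedent") is proved here, for EVERY finite discrete `Γ_K`-module over EVERY number field.  Seat `bsd-inputs-k4-p1` (D-0154 (2),
`--supports stmt-BirchSwinnertonDyer-20309`, helper).

The tree had the statement for `M = E[p^k]` only (`X11b.H2Support.eventually_localization_two_torsion_eq_zero`, whose local step
`twoCocycleClass_eq_zero_of_biinvariant_of_absInertia_le` is already module-generic) and, for `M = ℤ/m`, as clause (i) of the NAMED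
FACT `poitouTate_sha_zmod_mu K` (`Literature/NumberTheory/GaloisCohomology/PoitouTateSha.lean`).  The proof is the `E[p^k]` proof with
the elliptic-curve inputs (good reduction, `v ∤ p`) deleted — they were idle: a continuous `2`-cocycle `c` of the profinite `Γ_K` is
bi-invariant under an open normal `N₀` (uniform local constancy); the kernel of the action on the FINITE discrete `M` is open, so an
open normal `N ≤ N₀` acts trivially; `N ⊇ Gal(K̄/E)` for a finite Galois `E/K`; at the cofinitely many finite `v` whose inertia groups
fix `E` (`eventually_forall_inertia_mem_fixingSubgroup`), the restricted cocycle is bi-invariant under `res⁻¹(N) ⊇ I_{K_v}` acting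
trivially, hence its class vanishes (`cd(Γ_{K_v}/I_{K_v}) ≤ 1` on finite modules, `LocalFieldCdTwo.subsingleton_two_quotient_galUnr_of_finite`).

* **`eventually_localization_two_eq_zero`** — `loc_v x = 0` for all but finitely many finite `v`, any `x ∈ H²(K, M)`, `M` finite;
* `exists_finset_forall_localization_two_eq_zero` — the `Finset` form (B1 verbatim: `∃ S, ∀ v ∉ S, loc_v x = 0`);
* **`finite_setOf_localization_two_ne_zero`** — ALL places: `{v : Place K | loc_v x ≠ 0}` is finite (the infinite places are
  finitely many) — verbatim the shape of clause (i) of `poitouTate_sha_zmod_mu K`, for every finite module;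
* `finite_setOf_localization_two_trivial_zmod_ne_zero` — clause (i) of the named fact `poitouTate_sha_zmod_mu K` (`M = ℤ/m`, trivial
  action) PROVED for every number field `K` and every `m ≥ 1` (the clauses (ii) = Thm. 17.13 (b) stay named).

HONEST FRAMING. THEOREMS ONLY (no definition, no named fact, no `sorry`); unconditional; closes no item by itself (it is step B1 of
w2 g7's road to K4's stub 3 and one clause of a named fact); BSD is not proved by any of this.

References: [MilneADT2006] I §4 Lemma 4.8; [Harari2020] Prop. 17.6, Lemma 17.8 (p. 290–292); [SerreGaloisCohomology1997] II §4.3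
Prop. 12 (`cd(Ẑ) = 1`), I §2.2 Prop. 8.
-/

noncomputable section

open scoped Classical

open CategoryTheory Field NumberField IsDedekindDomain Topology
open Literature.NumberTheory.EllipticCurves
open Literature.NumberTheory.GaloisRepresentations
open scoped ContRepresentation

universe u

-- the summit's namespace `Summit.BirchSwinnertonDyer.BirchSwinnertonDyer.…` repeats the problem name by design (D-0017)
set_option linter.dupNamespace false

namespace Summit.BirchSwinnertonDyer.BirchSwinnertonDyer.Theorems.SignedEC.H2FiniteSupport

open Summit.BirchSwinnertonDyer.Rank1Residual.X11b
open Summit.BirchSwinnertonDyer.Rank1Residual.X11b.H2Support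

variable {K : Type u} [Field K] [NumberField K]
variable {M : Type u} [AddCommGroup M] [TopologicalSpace M] [DiscreteTopology M] [Finite M]

/-- **A class of `H²(K, M)`, `M` a FINITE discrete `Γ_K`-module, is locally zero at all but finitely many finite places** (Milne I
Lemma 4.8 / Harari Prop. 17.6: the diagonal map `β² : H²(K, M) → ∏_v H²(K_v, M)` lands in `⊕_v H²(K_v, M)`).  The cocycle is
bi-invariant under an open normal subgroup `N ⊴ Γ_K` acting trivially on `M`; `N ⊇ Gal(K̄/E)` for a finite Galois `E`; at the
cofinitely many `v` whose inertia fixes `E` the restricted cocycle is bi-invariant under `res⁻¹(N) ⊇ I_{K_v}` acting trivially, hence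
has trivial class (`X11b.H2Support.twoCocycleClass_eq_zero_of_biinvariant_of_absInertia_le`).
[cite: MilneADT2006, Ch. I §4, Lemma 4.8] [cite: Harari2020, Prop. 17.6 and Lemma 17.8] -/
theorem eventually_localization_two_eq_zero (ρ : DiscreteGaloisModule K M) (x : galoisCohomology ρ 2) :
    ∀ᶠ v : HeightOneSpectrum (𝓞 K) in Filter.cofinite, galoisCohomology.localization ρ (Sum.inr v) 2 x = 0 := by
  classical
  -- `H²` on explicit cocycles needs `LocallyCompactSpace Γ`: compactness of absolute Galois groups is a tree theorem
  haveI : CompactSpace (absoluteGaloisGroup K) := absoluteGaloisGroup_compactSpace K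
  obtain ⟨c, hc⟩ := twoCocycleClass_surjective _ x
  -- uniform local constancy of the cocycle, and triviality of the action, on an open normal `N`
  have hg : IsLocallyConstant (Function.uncurry fun σ τ ↦ c.1 (σ, τ)) :=
    (IsLocallyConstant.iff_continuous _).2 c.1.continuous
  obtain ⟨N₀, hN₀⟩ := exists_openNormalSubgroup_forall_mul_eq_of_isLocallyConstant₂ hg
  have hSopen : IsOpen {σ : absoluteGaloisGroup K | ∀ m : M, ρ σ m = m} := by
    have e : {σ : absoluteGaloisGroup K | ∀ m : M, ρ σ m = m} = ⋂ m, {σ | ρ σ m = m} := by ext σ; simp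
    rw [e]
    exact isOpen_iInter_of_finite fun m ↦ ρ.isOpen_setOf_apply_eq m
  obtain ⟨N, hN⟩ := ProfiniteGrp.exist_openNormalSubgroup_sub_open_nhds_of_one
    (hSopen.inter N₀.isOpen) ⟨fun m ↦ by rw [map_one]; rfl, N₀.one_mem⟩
  have hNρ : ∀ σ ∈ N, ∀ m, ρ σ m = m := fun σ hσ ↦ (hN hσ).1
  have hNN₀ : ∀ σ ∈ N, σ ∈ N₀ := fun σ hσ ↦ (hN hσ).2
  -- a finite Galois `E` with `Gal(K̄/E) ≤ N`
  obtain ⟨E, hEfin, hEgal, hE⟩ := exists_isGalois_mem_of_restrict_eq_one K N.isOpen N.one_mem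
  haveI := hEfin
  haveI := hEgal
  filter_upwards [eventually_forall_inertia_mem_fixingSubgroup (F := K) E] with v hv
  set F := v.adicCompletion K with hF
  haveI : CompactSpace (absoluteGaloisGroup F) := absoluteGaloisGroup_compactSpace F
  set r := absGaloisRestrict K F with hr_def
  -- `res (I_{K_v}) ≤ N`
  have hIN : ∀ ι ∈ absInertia F, r ι ∈ N := by
    intro ι hι
    have h1 : r ι ∈ (adicCompletionPrime K v).inertia (absoluteGaloisGroup K) := by
      rw [inertia_adicCompletionPrime_eq_map_absInertia K v]
      exact Subgroup.mem_map_of_mem _ hι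
    have h2 := hv _ (adicCompletionPrime_mem_primesAbove K v) _ h1
    apply hE
    have h3 : r ι ∈ (absRestrictNormalHom (K := K) E).ker := by
      change absoluteGaloisGroup.toAlgEquiv K (r ι) ∈ (AlgEquiv.restrictNormalHom E).ker
      rw [IntermediateField.restrictNormalHom_ker]
      exact h2
    exact h3
  -- the open normal subgroup `U = res⁻¹(N) ⊇ I_{K_v}` of `Γ_{K_v}`
  set U : Subgroup (absoluteGaloisGroup F) := N.toSubgroup.comap r.toMonoidHom with hU_def
  haveI : U.Normal := Subgroup.Normal.comap inferInstance _
  have hIU : absInertia F ≤ U := fun ι hι ↦ hIN ι hι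
  -- the local module and the restricted cocycle
  rw [← hc, localization_two_twoCocycleClass]
  refine twoCocycleClass_eq_zero_of_biinvariant_of_absInertia_le (F := F) (τ := GaloisRep.restrictField F ρ)
    U hIU (fun u hu m ↦ ?_) _ (fun σ τ u₁ hu₁ u₂ hu₂ ↦ ?_)
  · -- `U` acts trivially on `M`
    exact hNρ (r u) hu m
  · -- bi-invariance of the restricted cocycle
    change c.1 (r (σ * u₁), r (τ * u₂)) = c.1 (r σ, r τ)
    rw [map_mul, map_mul]
    exact hN₀ (r σ) (r τ) (r u₁) (hNN₀ _ hu₁) (r u₂) (hNN₀ _ hu₂)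

/-- **Finset form** (step B1 of the road to K4's `hbase`, verbatim): for `x ∈ H²(K, M)`, `M` finite, there is a finite set `S` of
finite places with `loc_v x = 0` for every `v ∉ S`. [cite: MilneADT2006, Ch. I §4, Lemma 4.8] -/
theorem exists_finset_forall_localization_two_eq_zero (ρ : DiscreteGaloisModule K M) (x : galoisCohomology ρ 2) :
    ∃ S : Finset (HeightOneSpectrum (𝓞 K)), ∀ v ∉ S, galoisCohomology.localization ρ (Sum.inr v) 2 x = 0 := by
  have h := eventually_localization_two_eq_zero ρ x
  rw [Filter.eventually_cofinite] at h
  refine ⟨h.toFinset, fun v hv => ?_⟩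
  by_contra hx
  exact hv (h.mem_toFinset.2 hx)

/-- **All places**: the set of places `v` (archimedean included) with `loc_v x ≠ 0` is finite, for `x ∈ H²(K, M)`, `M` finite —
the infinite places being finitely many.  This is the shape of clause (i) of the named fact `poitouTate_sha_zmod_mu K`, for every
finite discrete module. [cite: MilneADT2006, Ch. I §4, Lemma 4.8] [cite: Harari2020, Prop. 17.6 and Lemma 17.8] -/
theorem finite_setOf_localization_two_ne_zero (ρ : DiscreteGaloisModule K M) (x : galoisCohomology ρ 2) :
    {v : Place K | galoisCohomology.localization ρ v 2 x ≠ 0}.Finite := by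
  have hfin : {v : HeightOneSpectrum (𝓞 K) | galoisCohomology.localization ρ (Sum.inr v) 2 x ≠ 0}.Finite := by
    have h := eventually_localization_two_eq_zero ρ x
    rwa [Filter.eventually_cofinite] at h
  have hsub : {v : Place K | galoisCohomology.localization ρ v 2 x ≠ 0} ⊆
      Set.range (Sum.inl : InfinitePlace K → Place K) ∪
        Sum.inr '' {v : HeightOneSpectrum (𝓞 K) | galoisCohomology.localization ρ (Sum.inr v) 2 x ≠ 0} := by
    rintro (w | v) hv
    · exact Or.inl ⟨w, rfl⟩
    · exact Or.inr ⟨v, hv, rfl⟩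
  exact ((Set.finite_range _).union (hfin.image _)).subset hsub

/-- **Clause (i) of the named fact `poitouTate_sha_zmod_mu K`, PROVED**: for every number field `K`, every `m ≥ 1` and every
`x ∈ H²(K, ℤ/m)` (trivial action), the set of places `v` with `loc_v x ≠ 0` is finite (Harari Lemma 17.8 with Prop. 17.6 in degree
`2`).  The remaining clauses of the fact (Thm. 17.13 (b): finiteness and duality of `Ш¹(K, μ_m)`, `Ш²(K, ℤ/m)`) stay named.
[cite: Harari2020, Lemma 17.8 and Prop. 17.6] [cite: MilneADT2006, Ch. I §4, Lemma 4.8] -/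
theorem finite_setOf_localization_two_trivial_zmod_ne_zero {K : Type} [Field K] [NumberField K] (m : ℕ) [NeZero m]
    (x : galoisCohomology (ContinuousRep.trivial (absoluteGaloisGroup K) ℤ (ZMod m)) 2) :
    {v : Place K | galoisCohomology.localization
      (ContinuousRep.trivial (absoluteGaloisGroup K) ℤ (ZMod m)) v 2 x ≠ 0}.Finite :=
  finite_setOf_localization_two_ne_zero (ContinuousRep.trivial (absoluteGaloisGroup K) ℤ (ZMod m)) x

end Summit.BirchSwinnertonDyer.BirchSwinnertonDyer.Theorems.SignedEC.H2FiniteSupport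

end
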